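import Summits.Ventures.GridStability.Lyapunov.RelativeLffNonUniformCert
import Summits.Ventures.GridStability.Lyapunov.ClassicalSwingForward
import Summits.Ventures.GridStability.Models.ClassicalSwingLurie
import Summits.Ventures.GridStability.Models.RelativeSwingLFFOffDiag
import HarnessLib

/-!
# GridStability/Lyapunov/RelativeLffNonUniformRoa — generic NON-UNIFORM-damping LFF closed form,
# part 4: model-1's typed lossless models (`RecastData`) — the system, the hypothesis-free bridge,
# the certified region and the synchronisation sentence (every `n`, any certificate)

Venture GRIDFUSION, LFF lane, lead RULING R-LFF-NU-ROW (2026-08-27T06:44:49Z); seat gridfusion-lyap-1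
(g5); namespace `Summit.Ventures.GridStability.Lyapunov.RelativeLffNU`. Parts 1–3:
`RelativeLffNonUniform.lean` (p522397: (QKH) block algebra, the closed form, `closedFormCert`),
`RelativeLffNonUniformRefT.lean` (p524230: Sherman–Morrison `Ñ⁻¹`, `X ⪰ 0` from a scalar test),
`RelativeLffNonUniformCert.lean` (`Q ≻ 0`, `exists_closedFormCert`). HERE the generic objects are read on
model-1's typed lossless recast models `d : RecastData n` (machines `0..n`, exact rational data):

§10 `nuSystem d δs = sysOf M D refT lffEo (C/2) (θ*_p − θ*_q)` — Pai's machine-reference system of the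
typed model with its PER-MACHINE damping on the UNDIRECTED line set `LffPair n` (model-1
`RelativeSwingLFFOffDiag`; the 9-bus instance `WSCC9LffNU.sys` p504302 is the case `n = 2`);
`inputOf_apply`: the reciprocal input is `(w_(p,q)/M_i)([i = p] − [i = q])` (`sum_refT_mul_lffE`);
`sum_lffPair_antisym`: the undirected line sum out of machine `i` of an antisymmetric summand.
§11 THE HYPOTHESIS-FREE BRIDGE, generic in `n`: for lossless reciprocal data (`G_ij = 0`,
`B_ij = B_ji > 0` off the diagonal) `nuSystem_field_eq : (nuSystem d δs).field = (d.lurieSystem δs).field`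
(model-1's DIRECTED presentation p493501; `θ_pq = 0`, `E_pE_qY_pq = C_pq`, antisymmetry of the line
nonlinearity — `lineSum_eq`), hence `hasDerivWithinAt_state`: along EVERY solution of `d.toModel` the
machine-reference state solves `nuSystem d δs` (model-1's chain rule `RecastData.hasDerivWithinAt_lurieState`).
§12 THE SENTENCES for ANY certificate `Λ` of `nuSystem d δs` (closed form or not):
`well_subset_regionOfAttraction` (lit-6 `machineReference_well_subset_regionOfAttraction_of_gapQ`
[cite: VuTuritsyn2016, §IV and Appendices 9.2–9.3] with `ker E = 0` = `lffEo_injective_aux`,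
`ker T` = uniform speeds = `refT_ker`, damping ratios NOT all equal, `|θ*_p − θ*_q| < π/2`, rank-one facts,
level `c₀ < V(0) + (π − 2|δ*_k|)²/(2s_k) + K_k·vtGap(δ*_k)`): `{𝒫, V ≤ c₀}` positively invariant and
attracted to `0`; `synchronisation_of_isSolutionOn` (read on `d.toModel`: all `n + 1` speed deviations
`→ 0`, relative rotor angles `→` equilibrium); `synchronisation_of_state` (`∃!`: THE motion from every
machine state in the set, via lyap-2 `ClassicalSwingGlobal` + `ClassicalSwingForward`);
`exists_certificate` (the solver-free member for the typed model from the scalar test of part 3).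

THREE COLUMNS. CERTIFIED (kernel): theorem schemata for the MODEL CLASS = model-1's lossless
network-reduced classical multimachine models `RecastData.toModel` with per-machine damping `D_i > 0`
(MV-2L + per-instance MV-RD/MV-h12; NO MV-λ); CLASS = Vu–Turitsyn certificates on Pai's machine-reference
space. Instances supply: the data facts (`B > 0`, `G = 0` off-diagonal, `B` symmetric, acute circle
points), two ratios unequal, rank-one facts and a level (one `decide` each, as p505678). VALIDATED:
nothing. No sentence of this file says that any grid is stable. Definitions: `Mv`, `Dv`, `nuSystem`
(bookkeeping); no named fact; standard axioms.
-/

noncomputable section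

open Real Set Filter Matrix Finset
open scoped Topology
open Literature.MathematicalPhysics.PowerSystems
open Literature.MathematicalPhysics.PowerSystems.LyapunovFunctionFamily
open Literature.MathematicalPhysics.PowerSystems.ClassicalModel.LosslessSystem (vtGap)
open InternalNode (refT)
open Summit.Ventures.GridStability.Models

namespace Summit.Ventures.GridStability.Lyapunov.RelativeLffNU

variable {n : ℕ} (d : RecastData n)

/-! ### §10 The system of a typed lossless model on Pai's machine-reference space -/

/-- Inertias as reals. -/
def Mv : Fin (n + 1) → ℝ := fun i => (d.M i : ℝ)

/-- Dampings as reals (NOT assumed proportional to the inertias). -/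
def Dv : Fin (n + 1) → ℝ := fun i => (d.D i : ℝ)

/-- **The LFF system of a typed lossless model with its per-machine damping** on Pai's
machine-reference space (`n + 1` speed deviations `ω_i`, `n` relative angles `σ_a = (δ_{a+1} − δ_0) −
(θ*_{a+1} − θ*_0)`; UNDIRECTED line channels `LffPair n` = off-diagonal ordered pairs with weight
`w = C/2` each; reciprocal input `M⁻¹refTᵀEᵀW`): `sysOf M D refT lffEo (C/2) (θ*_p − θ*_q)`.
[cite: Pai1981, §3.6.3 eq. (3.45)] -/
def nuSystem (δs : Fin (n + 1) → ℝ) : System (Fin (n + 1) ⊕ Fin n) (RecastData.LffPair n) :=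
  sysOf (Mv d) (Dv d) (refT n) (RecastData.lffEo n) d.lffWo (RecastData.lffδso δs)

/-- `Σ_a T_{ai}·E_{(p,q),a} = [i = p] − [i = q]` for `T = refT`, `E = lffE` (the reference column works
out because `T`'s column `0` is `−𝟙`). -/
theorem sum_refT_mul_lffE (i p q : Fin (n + 1)) :
    ∑ a : Fin n, ((if i = a.succ then (1 : ℝ) else 0) - (if i = 0 then 1 else 0))
        * ((if p = a.succ then (1 : ℝ) else 0) - (if q = a.succ then 1 else 0))
      = (if i = p then 1 else 0) - (if i = q then 1 else 0) := by
  have hz : ∀ a : Fin n, ((0 : Fin (n + 1)) = a.succ) = False := fun a =>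
    propext ⟨fun h => Fin.succ_ne_zero a h.symm, False.elim⟩
  have cnt : ∀ r : Fin (n + 1), ∑ a : Fin n, (if r = a.succ then (1 : ℝ) else 0) = if r = 0 then 0 else 1 := by
    intro r
    cases r using Fin.cases with
    | zero => simp [hz]
    | succ b =>
        have hb : ∀ a : Fin n, (b.succ = a.succ) = (b = a) := fun a => propext Fin.succ_inj
        simp only [hb, Finset.sum_ite_eq, Finset.mem_univ, if_true, Fin.succ_ne_zero, if_false]
  cases i using Fin.cases with
  | zero =>
      simp only [hz, if_false, if_true, zero_sub, neg_one_mul, neg_sub, Finset.sum_sub_distrib, cnt]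
      by_cases hp : p = 0 <;> by_cases hq : q = 0 <;> simp [hp, hq, eq_comm]
  | succ a₀ =>
      have ha : ∀ a : Fin n, (a₀.succ = a.succ) = (a₀ = a) := fun a => propext Fin.succ_inj
      simp only [ha, Fin.succ_ne_zero, if_false, sub_zero, ite_mul, one_mul, zero_mul, Finset.sum_ite_eq,
        Finset.mem_univ, if_true]
      by_cases hp : p = a₀.succ <;> by_cases hq : q = a₀.succ <;> simp [hp, hq, eq_comm]

/-- **The reciprocal input, entrywise**: `(M⁻¹refTᵀEᵀW)_{i,(p,q)} = (w_(p,q)/M_i)·([i = p] − [i = q])` —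
channel `(p, q)` accelerates machine `p` and decelerates machine `q` (reference machine included). -/
theorem inputOf_apply (M : Fin (n + 1) → ℝ) (w : RecastData.LffPair n → ℝ) (i : Fin (n + 1))
    (k : RecastData.LffPair n) :
    inputOf M (refT n) (RecastData.lffEo n) w i k
      = 1 / M i * (w k * ((if i = k.1.1 then 1 else 0) - (if i = k.1.2 then 1 else 0))) := by
  rw [inputOf, Matrix.diagonal_mul, Matrix.mul_apply]
  congr 1
  have hT : ∀ a : Fin n, (refT n)ᵀ i a = (if i = a.succ then 1 else 0) - (if i = 0 then 1 else 0) :=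
    fun a => rfl
  have hE : ∀ a : Fin n, ((RecastData.lffEo n)ᵀ * Matrix.diagonal w) a k
      = ((if k.1.1 = a.succ then (1 : ℝ) else 0) - (if k.1.2 = a.succ then 1 else 0)) * w k := by
    intro a
    rw [Matrix.mul_diagonal, Matrix.transpose_apply]
    rfl
  simp only [hT, hE]
  have e : ∀ a : Fin n, ((if i = a.succ then (1 : ℝ) else 0) - (if i = 0 then 1 else 0))
      * (((if k.1.1 = a.succ then (1 : ℝ) else 0) - (if k.1.2 = a.succ then 1 else 0)) * w k)
      = (((if i = a.succ then (1 : ℝ) else 0) - (if i = 0 then 1 else 0))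
        * ((if k.1.1 = a.succ then (1 : ℝ) else 0) - (if k.1.2 = a.succ then 1 else 0))) * w k :=
    fun a => by ring
  rw [Finset.sum_congr rfl fun a _ => e a, ← Finset.sum_mul, sum_refT_mul_lffE, mul_comm]

/-- **The undirected line sum out of machine `i`** (antisymmetric summand `a`, e.g.
`a_pq = (C_pq/2)·G_pq` with `C` symmetric and `G` antisymmetric):
`Σ_{(p,q), p≠q} a_pq([i = p] − [i = q]) = 2·Σ_{q ≠ i} a_iq`. -/
theorem sum_lffPair_antisym (a : Fin (n + 1) → Fin (n + 1) → ℝ) (ha : ∀ p q, a q p = -a p q)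
    (i : Fin (n + 1)) :
    ∑ k : RecastData.LffPair n, a k.1.1 k.1.2 * ((if i = k.1.1 then 1 else 0) - (if i = k.1.2 then 1 else 0))
      = 2 * ∑ q ∈ univ.erase i, a i q := by
  have hdiag : ∀ p, a p p = 0 := fun p => by have := ha p p; linarith
  set F : Fin (n + 1) × Fin (n + 1) → ℝ :=
    fun kk => a kk.1 kk.2 * ((if i = kk.1 then 1 else 0) - (if i = kk.2 then 1 else 0)) with hF
  have h1 : ∑ k : RecastData.LffPair n, a k.1.1 k.1.2 * ((if i = k.1.1 then 1 else 0) - (if i = k.1.2 then 1 else 0))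
      = ∑ kk ∈ univ.filter (fun kk : Fin (n + 1) × Fin (n + 1) => kk.1 ≠ kk.2), F kk :=
    (Finset.sum_subtype (univ.filter fun kk : Fin (n + 1) × Fin (n + 1) => kk.1 ≠ kk.2)
      (p := fun kk : Fin (n + 1) × Fin (n + 1) => kk.1 ≠ kk.2) (fun kk => by simp) F).symm
  have h2 : ∑ kk ∈ univ.filter (fun kk : Fin (n + 1) × Fin (n + 1) => kk.1 ≠ kk.2), F kk = ∑ kk, F kk := by
    refine Finset.sum_filter_of_ne fun kk _ hne => ?_
    intro heq
    apply hne
    simp [hF, heq]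
  rw [h1, h2, Fintype.sum_prod_type]
  simp only [hF, mul_sub, Finset.sum_sub_distrib, mul_ite, mul_one, mul_zero]
  rw [Finset.sum_comm]
  simp only [Finset.sum_ite_eq, Finset.mem_univ, if_true]
  have h3 : ∑ p, a p i = -∑ p, a i p := by
    rw [← Finset.sum_neg_distrib]; exact Finset.sum_congr rfl fun p _ => ha i p
  rw [h3, sub_neg_eq_add, ← two_mul, ← Finset.add_sum_erase _ _ (Finset.mem_univ i), hdiag, zero_add]

/-! ### §11 The hypothesis-free bridge: the undirected presentation has model-1's directed field -/

/-- Lossless data: `θ_pq = 0` off the diagonal. -/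
theorem θpol_eq_zero (hG : ∀ i j, i ≠ j → d.G i j = 0) {p q : Fin (n + 1)} (hpq : p ≠ q) :
    d.toModel.θpol p q = 0 := by
  unfold ClassicalSwing.θpol
  have h : d.toModel.G p q = 0 := by
    show ((d.G p q : ℚ) : ℝ) = 0
    rw [hG p q hpq]; push_cast; rfl
  rw [h, zero_div, Real.arctan_zero]

/-- Lossless data with positive susceptances: the directed channel weight IS the coupling,
`E_pE_qY_pq = C_pq` (`p ≠ q`). -/
theorem channelWeight_eq (hB : ∀ i j, i ≠ j → 0 < d.B i j) (hG : ∀ i j, i ≠ j → d.G i j = 0)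
    {p q : Fin (n + 1)} (hpq : p ≠ q) :
    d.toModel.toLitNode.channelWeight d.toModel.Ypol (p, q) = (d.Cc p q : ℝ) := by
  unfold InternalNode.channelWeight
  rw [if_neg (show ¬ (p, q).1 = (p, q).2 from hpq)]
  have hBpos : (0 : ℝ) < d.toModel.B p q := d.toModel_B_pos hB p q hpq
  have hG0 : d.toModel.G p q = 0 := by
    show ((d.G p q : ℚ) : ℝ) = 0
    rw [hG p q hpq]; push_cast; rfl
  have hY : d.toModel.Ypol p q = d.toModel.B p q := by
    unfold ClassicalSwing.Ypol
    rw [hG0]; simp [Real.sqrt_sq hBpos.le]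
  rw [hY]
  show d.toModel.E p * d.toModel.E q * d.toModel.B p q = (d.Cc p q : ℝ)
  simp only [RecastData.toModel, RecastData.Cc]; push_cast; ring

/-- The nonlinearity of the undirected presentation on channel `(p, q)`:
`sin(θ*_p − θ*_q + (u_p − u_q)) − sin(θ*_p − θ*_q)`, `u = (0, σ)`. -/
theorem nuSystem_nonlin (δs : Fin (n + 1) → ℝ) (y : Fin (n + 1) ⊕ Fin n → ℝ) (k : RecastData.LffPair n) :
    (nuSystem d δs).nonlin y k
      = Real.sin (δs k.1.1 - δs k.1.2 + (Fin.cases (0 : ℝ) (y ∘ Sum.inr) k.1.1 - Fin.cases (0 : ℝ) (y ∘ Sum.inr) k.1.2))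
        - Real.sin (δs k.1.1 - δs k.1.2) := by
  unfold nuSystem sysOf
  rw [System.machineReference_nonlin]
  simp only [RecastData.lffδso, RecastData.lffδs, RecastData.lffEo_mulVec, RecastData.lffE_mulVec]

/-- The nonlinearity of model-1's directed presentation on an off-diagonal channel is the same
(`θ_pq = 0`). -/
theorem lurieSystem_nonlin (hG : ∀ i j, i ≠ j → d.G i j = 0) (δs : Fin (n + 1) → ℝ)
    (y : Fin (n + 1) ⊕ Fin n → ℝ) {p q : Fin (n + 1)} (hpq : p ≠ q) :
    (d.lurieSystem δs).nonlin y (p, q)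
      = Real.sin (δs p - δs q + (Fin.cases (0 : ℝ) (y ∘ Sum.inr) p - Fin.cases (0 : ℝ) (y ∘ Sum.inr) q))
        - Real.sin (δs p - δs q) := by
  unfold RecastData.lurieSystem InternalNode.toMachineReference
  rw [System.machineReference_nonlin]
  simp only [InternalNode.channelShift, θpol_eq_zero d hG hpq, add_zero, InternalNode.pairIncidence_mulVec]
  rfl

/-- `C` is symmetric when `B` is. -/
theorem Cc_symm (hBs : ∀ i j, d.B i j = d.B j i) (p q : Fin (n + 1)) : d.Cc q p = d.Cc p q := by
  simp only [RecastData.Cc, hBs q p]; ring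

/-- **The undirected reciprocal line sum out of machine `i` equals the directed sum** (the heart of
the bridge): antisymmetry of the line nonlinearity, symmetry of `C`, `E_pE_qY_pq = C_pq`. -/
theorem lineSum_eq (hB : ∀ i j, i ≠ j → 0 < d.B i j) (hG : ∀ i j, i ≠ j → d.G i j = 0)
    (hBs : ∀ i j, d.B i j = d.B j i) (δs : Fin (n + 1) → ℝ) (y : Fin (n + 1) ⊕ Fin n → ℝ)
    (i : Fin (n + 1)) :
    ∑ k : RecastData.LffPair n, inputOf (Mv d) (refT n) (RecastData.lffEo n) d.lffWo i k
        * (nuSystem d δs).nonlin y k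
      = ∑ k : Fin (n + 1) × Fin (n + 1),
          System.directedInput (fun i => 1 / d.toModel.toLitNode.M i) Prod.fst
            (d.toModel.toLitNode.channelWeight d.toModel.Ypol) i k * (d.lurieSystem δs).nonlin y k := by
  set u : Fin (n + 1) → ℝ := Fin.cases (0 : ℝ) (y ∘ Sum.inr) with hu
  set Gf : Fin (n + 1) → Fin (n + 1) → ℝ :=
    fun p q => Real.sin (δs p - δs q + (u p - u q)) - Real.sin (δs p - δs q) with hGf
  have hGanti : ∀ p q, Gf q p = -Gf p q := by
    intro p q
    simp only [hGf]
    rw [show δs q - δs p + (u q - u p) = -(δs p - δs q + (u p - u q)) by ring,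
      show δs q - δs p = -(δs p - δs q) by ring, Real.sin_neg, Real.sin_neg]
    ring
  -- the undirected side
  have hL : ∑ k : RecastData.LffPair n, inputOf (Mv d) (refT n) (RecastData.lffEo n) d.lffWo i k
        * (nuSystem d δs).nonlin y k
      = 1 / Mv d i * (2 * ∑ q ∈ univ.erase i, (d.Cc i q : ℝ) / 2 * Gf i q) := by
    rw [← sum_lffPair_antisym (fun p q => (d.Cc p q : ℝ) / 2 * Gf p q)
      (fun p q => by simp only [Cc_symm d hBs p q, hGanti p q]; ring) i, Finset.mul_sum]
    refine Finset.sum_congr rfl fun k _ => ?_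
    rw [inputOf_apply, nuSystem_nonlin]
    simp only [RecastData.lffWo, RecastData.lffW, hGf, hu]
    ring
  -- the directed side
  have hR : ∑ k : Fin (n + 1) × Fin (n + 1),
        System.directedInput (fun i => 1 / d.toModel.toLitNode.M i) Prod.fst
          (d.toModel.toLitNode.channelWeight d.toModel.Ypol) i k * (d.lurieSystem δs).nonlin y k
      = 1 / Mv d i * ∑ q ∈ univ.erase i, (d.Cc i q : ℝ) * Gf i q := by
    rw [Fintype.sum_prod_type, Finset.sum_comm]
    simp only [System.directedInput, Matrix.of_apply, ite_mul, zero_mul, Finset.sum_ite_eq',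
      Finset.mem_univ, if_true]
    rw [← Finset.add_sum_erase _ _ (Finset.mem_univ i)]
    have h0 : d.toModel.toLitNode.channelWeight d.toModel.Ypol (i, i) = 0 := by
      simp [InternalNode.channelWeight]
    rw [h0, zero_mul, zero_mul, zero_add, Finset.mul_sum]
    refine Finset.sum_congr rfl fun q hq => ?_
    have hqi : i ≠ q := fun h => (Finset.mem_erase.1 hq).1 h.symm
    rw [channelWeight_eq d hB hG hqi, lurieSystem_nonlin d hG δs y hqi, ClassicalSwing.toLitNode_M]
    simp only [hGf, hu, Mv, RecastData.toModel]
    ring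
  rw [hL, hR]
  congr 1
  rw [Finset.mul_sum]
  exact Finset.sum_congr rfl fun q _ => by ring

/-- **The undirected and the directed machine-reference presentations have THE SAME VECTOR FIELD**
(lossless reciprocal data: `G_ij = 0` and `B_ij = B_ji > 0` off the diagonal). -/
theorem nuSystem_field_eq (hB : ∀ i j, i ≠ j → 0 < d.B i j) (hG : ∀ i j, i ≠ j → d.G i j = 0)
    (hBs : ∀ i j, d.B i j = d.B j i) (δs : Fin (n + 1) → ℝ) (y : Fin (n + 1) ⊕ Fin n → ℝ) :
    (nuSystem d δs).field y = (d.lurieSystem δs).field y := by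
  funext j
  rcases j with i | a
  · have hL : (nuSystem d δs).field y (Sum.inl i) = -(Dv d i / Mv d i) * y (Sum.inl i)
        - ∑ k : RecastData.LffPair n, inputOf (Mv d) (refT n) (RecastData.lffEo n) d.lffWo i k
          * (nuSystem d δs).nonlin y k := by
      unfold nuSystem sysOf
      rw [System.machineReference_field_inl]
      rfl
    have hR : (d.lurieSystem δs).field y (Sum.inl i)
        = -(d.toModel.toLitNode.D i / d.toModel.toLitNode.M i) * y (Sum.inl i)
        - ∑ k : Fin (n + 1) × Fin (n + 1),
            System.directedInput (fun i => 1 / d.toModel.toLitNode.M i) Prod.fst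
              (d.toModel.toLitNode.channelWeight d.toModel.Ypol) i k * (d.lurieSystem δs).nonlin y k := by
      unfold RecastData.lurieSystem InternalNode.toMachineReference
      rw [System.machineReference_field_inl]
    have hlam : d.toModel.toLitNode.D i / d.toModel.toLitNode.M i = Dv d i / Mv d i := by
      rw [ClassicalSwing.toLitNode_M]; rfl
    rw [hL, hR, hlam, lineSum_eq d hB hG hBs δs y i]
  · unfold nuSystem sysOf RecastData.lurieSystem InternalNode.toMachineReference
    rw [System.machineReference_field_inr, System.machineReference_field_inr]

/-- **HYPOTHESIS-FREE BRIDGE.** Along EVERY solution of the typed classical model `d.toModel` on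
`univ` (lossless reciprocal data, A1 equilibrium data `EqData δs`) the machine-reference state
`(ω | σ)` solves the undirected system `nuSystem d δs`, within every time set.
[cite: Pai1981, §3.6.3 eq. (3.45)] -/
theorem hasDerivWithinAt_state (hB : ∀ i j, i ≠ j → 0 < d.B i j) (hG : ∀ i j, i ≠ j → d.G i j = 0)
    (hBs : ∀ i j, d.B i j = d.B j i) {δs : Fin (n + 1) → ℝ} (hE : d.EqData δs)
    {c : ℝ → ClassicalSwing.State (n + 1)} (hc : d.toModel.IsSolutionOn c univ) {s : Set ℝ} (t : ℝ) :
    HasDerivWithinAt (fun τ => d.lurieState δs (c τ))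
      ((nuSystem d δs).field (d.lurieState δs (c t))) s t := by
  rw [nuSystem_field_eq d hB hG hBs]
  exact d.hasDerivWithinAt_lurieState hB hE hc t

/-! ### §12 The certified region and the synchronisation sentence (every `n`, any certificate) -/

/-- Non-uniform damping read on the rationals: `D_i/M_i ≠ D_j/M_j` for some pair. -/
theorem hlam_of_rat (h : ∃ i j : Fin (n + 1), d.D i / d.M i ≠ d.D j / d.M j) :
    ∃ i j : Fin (n + 1), lamOf (Mv d) (Dv d) i ≠ lamOf (Mv d) (Dv d) j := by
  obtain ⟨i, j, hij⟩ := h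
  refine ⟨i, j, ?_⟩
  simp only [lamOf, Mv, Dv]
  exact_mod_cast hij

/-- **THE CERTIFIED SYNCHRONISATION REGION on Pai's machine-reference space, for ANY certificate of
the undirected system of a typed lossless model with NON-UNIFORM damping** (lit-6's observability
form [cite: VuTuritsyn2016, §IV and Appendices 9.2–9.3; Pai1981, §3.6.1 (i), §3.6.3 eq. (3.45)]):
damping ratios not all equal, equilibrium line angles `|θ*_p − θ*_q| < π/2`, rank-one facts
`s_k·Q − C_kᵀC_k ⪰ 0` and a level `c₀ < V(0) + (π − 2|δ*_k|)²/(2s_k) + K_k·vtGap(δ*_k)` on every channel: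
`{y ∈ 𝒫 : V y ≤ c₀}` is positively invariant and EVERY global solution from it tends to `0` (all
`n + 1` speed deviations `→ 0`, relative angles `→` the equilibrium). The certificate may be the closed
form (`closedFormCert` / `exists_certificate`) or any other member. -/
theorem well_subset_regionOfAttraction {δs : Fin (n + 1) → ℝ} (Λ : Certificate (nuSystem d δs))
    (hlam : ∃ i j : Fin (n + 1), lamOf (Mv d) (Dv d) i ≠ lamOf (Mv d) (Dv d) j)
    (hδs : ∀ k : RecastData.LffPair n, |RecastData.lffδso δs k| < π / 2)
    {s : RecastData.LffPair n → ℝ} (hs0 : ∀ k, 0 < s k)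
    (hs : ∀ k, (s k • Λ.Q - Matrix.vecMulVec ((nuSystem d δs).C k) ((nuSystem d δs).C k)).PosSemidef)
    {c₀ : ℝ}
    (hc₀ : ∀ k, c₀ < Λ.V 0 + (π - 2 * |RecastData.lffδso δs k|) ^ 2 / (2 * s k)
      + Λ.kK k * vtGap (RecastData.lffδso δs k))
    {y : Fin (n + 1) ⊕ Fin n → ℝ} (hy : y ∈ (nuSystem d δs).polytope) (hyc : Λ.V y ≤ c₀) :
    (∃ X : ℝ → Fin (n + 1) ⊕ Fin n → ℝ, X 0 = y ∧
        ∀ τ : ℝ, ∀ t ∈ Icc 0 τ, HasDerivWithinAt X ((nuSystem d δs).field (X t)) (Icc 0 τ) t) ∧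
      ∀ X : ℝ → Fin (n + 1) ⊕ Fin n → ℝ, X 0 = y →
        (∀ τ : ℝ, ∀ t ∈ Icc 0 τ, HasDerivWithinAt X ((nuSystem d δs).field (X t)) (Icc 0 τ) t) →
        (∀ t, 0 ≤ t → X t ∈ (nuSystem d δs).polytope ∧ Λ.V (X t) ≤ c₀) ∧ Tendsto X atTop (𝓝 0) :=
  Λ.machineReference_well_subset_regionOfAttraction_of_gapQ
    (fun v hv => RecastData.lffEo_injective_aux v hv) (fun ω hω => InternalNode.refT_ker ω hω) hlam hδs
    hs0 hs hc₀ hy hyc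

/-- **The same read on model-1's typed classical model** (lossless reciprocal data with `B_ij > 0` off
the diagonal, A1 equilibrium data `EqData δs`): EVERY solution `c` of `d.toModel` on `univ` whose
machine-reference state `((ω_i)_i | ((δ_{a+1} − δ_0) − (θ*_{a+1} − θ*_0))_a)` starts in `𝒫` with
`V ≤ c₀` keeps `{𝒫, V ≤ c₀}` for all `t ≥ 0` and has that state `→ 0`: ALL speed deviations `→ 0` and
every relative rotor angle `→` its equilibrium value. MODELLED: lossless network-reduced classical model
with per-machine damping (MV-2L; NO uniform-λ hypothesis); no sentence here says a grid is stable.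
[cite: VuTuritsyn2016, §IV set ℛ; Pai1981, §3.6.3 eq. (3.45)] -/
theorem synchronisation_of_isSolutionOn (hB : ∀ i j, i ≠ j → 0 < d.B i j)
    (hG : ∀ i j, i ≠ j → d.G i j = 0) (hBs : ∀ i j, d.B i j = d.B j i) {δs : Fin (n + 1) → ℝ}
    (hE : d.EqData δs) (Λ : Certificate (nuSystem d δs))
    (hlam : ∃ i j : Fin (n + 1), lamOf (Mv d) (Dv d) i ≠ lamOf (Mv d) (Dv d) j)
    (hδs : ∀ k : RecastData.LffPair n, |RecastData.lffδso δs k| < π / 2)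
    {s : RecastData.LffPair n → ℝ} (hs0 : ∀ k, 0 < s k)
    (hs : ∀ k, (s k • Λ.Q - Matrix.vecMulVec ((nuSystem d δs).C k) ((nuSystem d δs).C k)).PosSemidef)
    {c₀ : ℝ}
    (hc₀ : ∀ k, c₀ < Λ.V 0 + (π - 2 * |RecastData.lffδso δs k|) ^ 2 / (2 * s k)
      + Λ.kK k * vtGap (RecastData.lffδso δs k))
    {c : ℝ → ClassicalSwing.State (n + 1)} (hc : d.toModel.IsSolutionOn c univ)
    (hy : d.lurieState δs (c 0) ∈ (nuSystem d δs).polytope) (hyc : Λ.V (d.lurieState δs (c 0)) ≤ c₀) :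
    (∀ t, 0 ≤ t → d.lurieState δs (c t) ∈ (nuSystem d δs).polytope ∧ Λ.V (d.lurieState δs (c t)) ≤ c₀) ∧
      Tendsto (fun t => d.lurieState δs (c t)) atTop (𝓝 0) := by
  obtain ⟨-, hall⟩ := well_subset_regionOfAttraction d Λ hlam hδs hs0 hs hc₀ hy hyc
  exact hall (fun t => d.lurieState δs (c t)) rfl fun τ t _ => hasDerivWithinAt_state d hB hG hBs hE hc t

/-- **… and about THE MOTION from every machine state in the certified set** (`∃!`: global flow of the
classical model, lyap-2 `ClassicalSwingGlobal` + `ClassicalSwingForward`): exactly one solution on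
`univ` through `x₀`, and it synchronises. [cite: VuTuritsyn2016, §IV set ℛ; Teschl2012, Thm. 2.2] -/
theorem synchronisation_of_state (hB : ∀ i j, i ≠ j → 0 < d.B i j)
    (hG : ∀ i j, i ≠ j → d.G i j = 0) (hBs : ∀ i j, d.B i j = d.B j i) {δs : Fin (n + 1) → ℝ}
    (hE : d.EqData δs) (Λ : Certificate (nuSystem d δs))
    (hlam : ∃ i j : Fin (n + 1), lamOf (Mv d) (Dv d) i ≠ lamOf (Mv d) (Dv d) j)
    (hδs : ∀ k : RecastData.LffPair n, |RecastData.lffδso δs k| < π / 2)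
    {s : RecastData.LffPair n → ℝ} (hs0 : ∀ k, 0 < s k)
    (hs : ∀ k, (s k • Λ.Q - Matrix.vecMulVec ((nuSystem d δs).C k) ((nuSystem d δs).C k)).PosSemidef)
    {c₀ : ℝ}
    (hc₀ : ∀ k, c₀ < Λ.V 0 + (π - 2 * |RecastData.lffδso δs k|) ^ 2 / (2 * s k)
      + Λ.kK k * vtGap (RecastData.lffδso δs k))
    (x₀ : ClassicalSwing.State (n + 1)) (hy : d.lurieState δs x₀ ∈ (nuSystem d δs).polytope)
    (hyc : Λ.V (d.lurieState δs x₀) ≤ c₀) :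
    (∃! c : ℝ → ClassicalSwing.State (n + 1), c 0 = x₀ ∧ d.toModel.IsSolutionOn c univ) ∧
      ∀ c : ℝ → ClassicalSwing.State (n + 1), c 0 = x₀ → d.toModel.IsSolutionOn c univ →
        (∀ t, 0 ≤ t → d.lurieState δs (c t) ∈ (nuSystem d δs).polytope ∧
            Λ.V (d.lurieState δs (c t)) ≤ c₀) ∧
          Tendsto (fun t => d.lurieState δs (c t)) atTop (𝓝 0) :=
  d.toModel.existsUnique_and_forall
    (I := fun x => d.lurieState δs x ∈ (nuSystem d δs).polytope ∧ Λ.V (d.lurieState δs x) ≤ c₀)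
    (fun _ hc hI => synchronisation_of_isSolutionOn d hB hG hBs hE Λ hlam hδs hs0 hs hc₀ hc hI.1 hI.2)
    ⟨hy, hyc⟩

/-- **A solver-free certificate for the typed lossless model** (specialisation of
`exists_closedFormCert`): positive `M`, `D`, couplings `C_ij > 0` (`i ≠ j`), and scalars `c′, h, τ > 0`
with `Σ M_i²/D_i ≤ τ²·ΣD` and `h·(M_i/D_i + τ) ≤ c′` give a member of the family for `nuSystem d δs`
with `Q = QOf`, `K = c′·C/2`, `H = h·C/2`. [cite: VuTuritsyn2016, §III eq. (QKH)] -/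
theorem exists_certificate (δs : Fin (n + 1) → ℝ) (c' h : ℝ) (hM : ∀ i, 0 < d.M i)
    (hD : ∀ i, 0 < d.D i) (hC : ∀ i j : Fin (n + 1), i ≠ j → 0 < d.Cc i j) (hc' : 0 < c') (hh : 0 < h)
    {τ : ℝ} (hτ : 0 < τ) (hτ2 : ∑ i, Mv d i ^ 2 / Dv d i ≤ τ ^ 2 * Dsum (Dv d))
    (hcond : ∀ i, h * (Mv d i / Dv d i + τ) ≤ c') :
    ∃ Λ : Certificate (nuSystem d δs), Λ.Q = QOf (Mv d) (Dv d) (refT n) (NinvD (Dv d)) c' h ∧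
      Λ.kK = (fun k => c' * d.lffWo k) ∧ Λ.h = (fun k => h * d.lffWo k) :=
  exists_closedFormCert (Mv d) (Dv d) (RecastData.lffEo n) d.lffWo (RecastData.lffδso δs) c' h
    (fun i => by unfold Mv; exact_mod_cast hM i) (fun i => by unfold Dv; exact_mod_cast hD i)
    (d.lffWo_pos hC) hc' hh hτ hτ2 hcond

end Summit.Ventures.GridStability.Lyapunov.RelativeLffNU

end
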